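import Summits.QuantumFields.BalabanUV.T4Continuum.Support.NE3CovariantLineSums
import Summits.QuantumFields.BalabanUV.T4Continuum.Support.NE3GaugeDirFrames
import Summits.QuantumFields.BalabanUV.T4Continuum.Support.AveragingDeficitBlockDensity
import Summits.QuantumFields.BalabanUV.T4Continuum.Support.NE3CovariantStokes
import Summits.QuantumFields.BalabanUV.T4Continuum.Support.NE3BlockLineAverage
import HarnessLib

/-!
# T⁴ programme, node NE3, route H♮ (ρ-g22-2) · row K3 (file 1) — THE STRAIGHT COVARIANT BLOCK-LINE AVERAGE OF AN EXACT FIELD: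
# `Qstr L W (gaugeDir W ζ) = gaugeDir (cavg L W) (transported block mean of ζ) + def(ζ)` EXACTLY at any `W`,
# with `‖def(ζ)(z,κ)‖ ≤ 10·loopRad(d,L,a)·(block mean of ‖ζ‖ over B(c₊))` in the small-field class

NE3 formalisation swarm `b2b-balaban-t4-ne3-formalise-*`, LEAF PROVER 04 (gen 5), row **K3** of the owner's design ruling ρ-g22-2
(`t4-ne3-p1-g22`, memo `HOME/t4/b2b-balaban-t4-ne3-p1/g22/D-ne3p1-g22-1.md` §2 S3 «LINE SUMS OF η′ ARE EXACT UP TO TOLERANCE: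
S_W(D_Wζ′) = D_U(bmean_W ζ′) + def(ζ′) — covariant line sums of an exact field telescope along lines EXACTLY; def = the comb-vs-`bseg`
transport mismatch acting on ζ′», §4 «K3 … → leaf-04 lineage (C1 kit)»; SHAPE + INTENT HOME/CLAIMS.log l.17765).

ONE LEVEL.  `S_W` at one level is this lineage's C1 object `NE3CovariantLineSums.Qstr` (the block average of the straight segments
`[x, x + Le_κ]` transported to the corner through the trees and to the end frame through `V̄(c)⁻¹`, B7 (125)); an exact field is a
linearised gauge direction `gaugeDir W ζ` (`(x,μ) ↦ Ad_{W(x,μ)⁻¹} ζ(x) − ζ(x+e_μ)`), whose linearised holonomy TELESCOPES along every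
word (`NE3GaugeDirFrames.dhol_gaugeDir`, this lineage).  Notation for the coarse bond `c = (q, κ)`, `q = L•z`, `q′ = L•(z+e_κ)`:
`T_r = W(Γ_{q,q+r})`, `S_r = W([q+r, q+r+Le_κ])`, `T′_r = W(Γ_{q′,q′+r})`, `V̄ = bavg L W q κ = cavg L W z κ`.

CONTENT (all [folklore]; 0 sorry; 0 def — the defect def(ζ) is kept as the explicit difference, no data def):
§1 `segMain_gaugeDir` — `segMain L W (gaugeDir W ζ) q κ = Σ_r L^{−d}•Ad_{T_r} ζ(q+r) − Σ_r L^{−d}•Ad_{T_r S_r} ζ(q′+r)` (exact, any W);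
§2 **`Qstr_gaugeDir_sub_eq`** (exact, any W): `Qstr L W (gaugeDir W ζ) z κ − gaugeDir (cavg L W) (w ↦ Σ_r L^{−d}•Ad_{W(Γ_{Lw,Lw+r})} ζ(L•w + r)) z κ
   = Σ_r L^{−d}•(Ad_{T′_r} ζ(q′+r) − Ad_{V̄⁻¹T_rS_r} ζ(q′+r))` =: def(ζ)(z,κ) (`q′ = L•z + L•e_κ`, `T′_r = W(Γ_{q′,q′+r})`) — the inline
   transported block mean is the lambda of `NE3GaugeDirFrames.Qbar_gaugeDir` (to be NAMED `bmeanW` by leaf-02-g5's K0a; `rfl` bridge);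
§3 `norm_Ad_sub_Ad_le` (`‖Ad_a X − Ad_b X‖ ≤ 2‖b⁻¹a − 1‖·‖X‖` for unitary units), the unit identity `mismatch_unit_eq`
   (`(V̄⁻¹T_rS_r)⁻¹T′_r = u·(W_{c,r}⁻¹e^{X_c})·u⁻¹`, `u = T′_r⁻¹V_c⁻¹`, from `W(Γ_{c,x}) = W_{c,x}V_c = T_rS_rT′_r⁻¹` and `V̄ = e^{X_c}V_c`),
   `norm_mismatch_sub_one_le` (`≤ 5·loopRad d L a` in the small-field class: `‖W_{c,r} − 1‖ ≤ loopRad`, `‖e^{X_c} − 1‖ ≤ 4·loopRad`);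
§4 **`norm_Qstr_gaugeDir_sub_le`** — `[Nonempty n]`, unitary `W`, `0 ≤ a`, `512(d+1)(d+4)L²a ≤ 1`, `SmallField W a`:
   `‖def(ζ)(z,κ)‖ ≤ 10·loopRad d L a·Σ_r L^{−d}‖ζ(q′ + r)‖` — k-free, `O(L²a)` = `O(b∕L²)` per level;
§5 `blockMean_norm_sq_le` (Jensen on a block) and **`sum_norm_Qstr_gaugeDir_sub_sq_le`** — for an `(L·N)`-periodic `ζ`:
   `Σ_{z∈periodBox N} Σ_κ ‖def(ζ)(z,κ)‖² ≤ d·(10·loopRad d L a)²·(L^d)⁻¹·Σ_{x∈periodBox (L·N)} ‖ζ x‖²` (the design's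
   `‖def(ζ′)(z,κ)‖ ≤ C_d(b∕L²)·M^{−d∕2}‖ζ′‖_{B(z+e_κ)}` summed over the torus, at one level).

HONEST: one-level covariant kinematics on OUR frame (bookkeeping + one crude transport estimate); nothing about Bałaban's minimisers;
(P♮)_W, (ML_w) at W ≠ 1, T-E_w, NE3 NOT proved; spine PROVED 0∕9; finite T⁴ rung (B)+1 — NOT infinite volume, NOT mass gap, NOT
BetaPertH, NOT Clay.  PLACEMENT: `Summits/QuantumFields/BalabanUV/` (context: [Balaban1985Averaging] (122)–(125) pp. 35–36).
-/

set_option autoImplicit false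

open scoped BigOperators Matrix.Norms.L2Operator
open Finset

namespace Summit.QuantumFields.BalabanUV.T4Continuum.NE3ExactLineSums

open Literature.MathematicalPhysics.QuantumFieldTheory.Balaban1983to89
open B7Prop1Explicit B7Prop2Explicit
open T4AveragingDeficitWall (IsUnitaryCfg SmallField Ad)
open T4AveragingDeficitNonAbelian (Ad_mul Ad_sub)
open AveragingDeficitTransport (dhol norm_Ad_of_unitary mem_U1_of_unitary)
open AveragingDeficitNearIdentity (norm_Ad_sub_le Ad_sum Ad_real_smul)
open AveragingDeficitChartCalculus (cavg)
open BlockAveragePushDirGauge (gaugeDir)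
open BlockAverageDbarLinBound (segMain)
open NE3CovariantLineSums (Qstr)
open NE3GaugeDirFrames (dhol_gaugeDir)
open NE3CovariantStokes (Ad_sub_Ad)
open AveragingDeficitBlockDensity (norm_expUnit_Xavg_sub_one_le)
open SpreadLift (loopRad loopRad_le loopBound_of_smallField)
open T4AveragingDeficitWallBoundary (periodBox sum_periodBox_shift)
open NE3BlockLineAverage (sum_univ_boxVec sum_periodBox_blocks)

noncomputable section

variable {d : ℕ} {n : Type*} [Fintype n] [DecidableEq n]

/-! ## §1 The main term of an exact field telescopes -/

/-- **THE TRANSPORTED STRAIGHT SEGMENTS OF A GAUGE DIRECTION TELESCOPE**: with `T_r = W(Γ_{q,q+r})`, `S_r = W([q+r, q+r+Le_κ])`,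
`segMain L W (gaugeDir W ζ) q κ = Σ_r L^{−d}•Ad_{T_r} ζ(q + r) − Σ_r L^{−d}•Ad_{T_r·S_r} ζ(q + Le_κ + r)` — exact at every background.
[cite: Balaban1985Averaging, (125) p.36] -/
theorem segMain_gaugeDir (L : ℕ) (W : Site d → Fin d → (Matrix n n ℂ)ˣ) (ζ : Site d → Matrix n n ℂ) (q : Site d) (κ : Fin d) :
    segMain L W (gaugeDir W ζ) q κ
      = ∑ r : Fin d → Fin L, (((L : ℝ) ^ d)⁻¹) • Ad (hol W q (treeWord (boxVec L r))) (ζ (q + boxVec L r))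
        - ∑ r : Fin d → Fin L, (((L : ℝ) ^ d)⁻¹) •
            Ad (hol W q (treeWord (boxVec L r)) * hol W (q + boxVec L r) (seg κ L)) (ζ (q + (L : ℤ) • e κ + boxVec L r)) := by
  unfold segMain
  rw [← Finset.sum_sub_distrib]
  refine Finset.sum_congr rfl fun r _ => ?_
  rw [dhol_gaugeDir W ζ (seg κ L) (q + boxVec L r), disp_seg, Ad_sub, Ad_mul, smul_sub,
    show q + boxVec L r + (L : ℤ) • e κ = q + (L : ℤ) • e κ + boxVec L r by abel]

/-! ## §2 The defect and the exact decomposition of `Qstr (gaugeDir ζ)` -/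

/-- **`S_W(D_Wζ) = D_U(bmean_W ζ) + def(ζ)` AT ONE LEVEL, EXACT AT EVERY BACKGROUND**: the straight covariant block-line average of
a gauge direction minus the coarse gauge direction of the transported block mean of its generator IS the one-level transport mismatch
`Σ_r L^{−d}•(Ad_{T′_r} ζ(q′+r) − Ad_{V̄⁻¹T_rS_r} ζ(q′+r))`, `q = L•z`, `q′ = L•z + L•e_κ`, `T′_r = W(Γ_{q′,q′+r})`, `V̄ = bavg L W q κ`
(the generator over `B(c₊)` read once through its own trees and once through tree·segment·`V̄⁻¹`). [folklore] -/
theorem Qstr_gaugeDir_sub_eq (L : ℕ) (W : Site d → Fin d → (Matrix n n ℂ)ˣ) (ζ : Site d → Matrix n n ℂ) (z : Site d) (κ : Fin d) :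
    Qstr L W (gaugeDir W ζ) z κ
        - gaugeDir (cavg L W) (fun w => ∑ r : Fin d → Fin L, (((L : ℝ) ^ d)⁻¹) •
            Ad (hol W ((L : ℤ) • w) (treeWord (boxVec L r))) (ζ ((L : ℤ) • w + boxVec L r))) z κ
      = ∑ r : Fin d → Fin L, (((L : ℝ) ^ d)⁻¹) •
    (Ad (hol W ((L : ℤ) • z + (L : ℤ) • e κ) (treeWord (boxVec L r))) (ζ ((L : ℤ) • z + (L : ℤ) • e κ + boxVec L r))
      - Ad ((bavg L W ((L : ℤ) • z) κ)⁻¹ * (hol W ((L : ℤ) • z) (treeWord (boxVec L r))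
          * hol W ((L : ℤ) • z + boxVec L r) (seg κ L))) (ζ ((L : ℤ) • z + (L : ℤ) • e κ + boxVec L r))) := by
  have hq' : (L : ℤ) • (z + e κ) = (L : ℤ) • z + (L : ℤ) • e κ := smul_add _ _ _
  -- LHS: `Ad_{V̄⁻¹}` of the telescoped main term
  have hL1 : Qstr L W (gaugeDir W ζ) z κ
      = Ad (bavg L W ((L : ℤ) • z) κ)⁻¹
          (∑ r : Fin d → Fin L, (((L : ℝ) ^ d)⁻¹) • Ad (hol W ((L : ℤ) • z) (treeWord (boxVec L r))) (ζ ((L : ℤ) • z + boxVec L r)))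
        - ∑ r : Fin d → Fin L, (((L : ℝ) ^ d)⁻¹) •
            Ad ((bavg L W ((L : ℤ) • z) κ)⁻¹ * (hol W ((L : ℤ) • z) (treeWord (boxVec L r))
              * hol W ((L : ℤ) • z + boxVec L r) (seg κ L))) (ζ ((L : ℤ) • z + (L : ℤ) • e κ + boxVec L r)) := by
    unfold Qstr
    rw [segMain_gaugeDir, Ad_sub]
    congr 1
    rw [Ad_sum]
    exact Finset.sum_congr rfl fun r _ => by rw [Ad_real_smul, ← Ad_mul]
  -- RHS: the coarse gauge direction of the transported block mean, read at `c = (z, κ)`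
  have hR1 : gaugeDir (cavg L W) (fun w => ∑ r : Fin d → Fin L, (((L : ℝ) ^ d)⁻¹) •
        Ad (hol W ((L : ℤ) • w) (treeWord (boxVec L r))) (ζ ((L : ℤ) • w + boxVec L r))) z κ
      = Ad (bavg L W ((L : ℤ) • z) κ)⁻¹
          (∑ r : Fin d → Fin L, (((L : ℝ) ^ d)⁻¹) • Ad (hol W ((L : ℤ) • z) (treeWord (boxVec L r))) (ζ ((L : ℤ) • z + boxVec L r)))
        - ∑ r : Fin d → Fin L, (((L : ℝ) ^ d)⁻¹) •
            Ad (hol W ((L : ℤ) • z + (L : ℤ) • e κ) (treeWord (boxVec L r))) (ζ ((L : ℤ) • z + (L : ℤ) • e κ + boxVec L r)) := by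
    simp only [gaugeDir, cavg, hq']
  rw [hL1, hR1]
  simp only [smul_sub, Finset.sum_sub_distrib]
  abel

/-! ## §3 The transport mismatch is within `5·loopRad` of the identity -/

/-- `‖Ad_a X − Ad_b X‖ ≤ 2·‖b⁻¹a − 1‖·‖X‖` for unitary units `a`, `b`. [folklore] -/
theorem norm_Ad_sub_Ad_le [Nonempty n] {a b : (Matrix n n ℂ)ˣ} (ha : a ∈ unitaryUnits (Matrix n n ℂ))
    (hb : b ∈ unitaryUnits (Matrix n n ℂ)) (X : Matrix n n ℂ) :
    ‖Ad a X - Ad b X‖ ≤ 2 * ‖(((b⁻¹ * a : (Matrix n n ℂ)ˣ)) : Matrix n n ℂ) - 1‖ * ‖X‖ := by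
  rw [Ad_sub_Ad, norm_Ad_of_unitary hb]
  exact norm_Ad_sub_le ((unitaryUnits (Matrix n n ℂ)).mul_mem ((unitaryUnits (Matrix n n ℂ)).inv_mem hb) ha) X

/-- Conjugation by a unitary unit does not change the distance to `1`: `‖u·g·u⁻¹ − 1‖ = ‖g − 1‖`. [folklore] -/
theorem norm_conj_sub_one_eq {u : (Matrix n n ℂ)ˣ} (hu : u ∈ unitaryUnits (Matrix n n ℂ)) (g : (Matrix n n ℂ)ˣ) :
    ‖(((u * g * u⁻¹ : (Matrix n n ℂ)ˣ)) : Matrix n n ℂ) - 1‖ = ‖((g : (Matrix n n ℂ)ˣ) : Matrix n n ℂ) - 1‖ := by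
  have h : (((u * g * u⁻¹ : (Matrix n n ℂ)ˣ)) : Matrix n n ℂ) - 1 = Ad u (((g : (Matrix n n ℂ)ˣ) : Matrix n n ℂ) - 1) := by
    simp only [Ad, Units.val_mul, Matrix.mul_sub, Matrix.sub_mul, Matrix.mul_one, Units.mul_inv]
  rw [h, norm_Ad_of_unitary hu]

/-- **THE MISMATCH UNIT**: `(V̄⁻¹·T_r·S_r)⁻¹·T′_r = u·(W_{c,r}⁻¹·e^{X_c})·u⁻¹` with `u = T′_r⁻¹·V_c⁻¹` — from `W(Γ_{c,x}) = T_r·S_r·T′_r⁻¹ = W_{c,r}·V_c`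
(B7 (42): `W_{c,x} = W(Γ_{c,x})V(c)⁻¹`) and `V̄ = e^{X_c}·V_c` (B7 (42)). [cite: Balaban1985Averaging, (42) p.23] -/
theorem mismatch_unit_eq (L : ℕ) (W : Site d → Fin d → (Matrix n n ℂ)ˣ) (q : Site d) (κ : Fin d) (r : Fin d → Fin L) :
    ((bavg L W q κ)⁻¹ * (hol W q (treeWord (boxVec L r)) * hol W (q + boxVec L r) (seg κ L)))⁻¹
        * hol W (q + (L : ℤ) • e κ) (treeWord (boxVec L r))
      = ((hol W (q + (L : ℤ) • e κ) (treeWord (boxVec L r)))⁻¹ * (hol W q (seg κ L))⁻¹)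
          * ((Wcx L W q κ (boxVec L r))⁻¹ * expUnit (Xavg L W q κ))
          * ((hol W (q + (L : ℤ) • e κ) (treeWord (boxVec L r)))⁻¹ * (hol W q (seg κ L))⁻¹)⁻¹ := by
  -- `T_r·S_r = W(tree ++ seg) = W(Γ_{c,x})·T′_r = W_{c,r}·V_c·T′_r`
  have hts : hol W q (treeWord (boxVec L r)) * hol W (q + boxVec L r) (seg κ L)
      = Wcx L W q κ (boxVec L r) * hol W q (seg κ L) * hol W (q + (L : ℤ) • e κ) (treeWord (boxVec L r)) := by
    have h1 : hol W q (treeWord (boxVec L r) ++ seg κ L) = hol W q (treeWord (boxVec L r)) * hol W (q + boxVec L r) (seg κ L) := by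
      rw [hol_append, disp_treeWord]
    have h2 : hol W q (gammaWord L κ (boxVec L r))
        = hol W q (treeWord (boxVec L r) ++ seg κ L) * (hol W (q + (L : ℤ) • e κ) (treeWord (boxVec L r)))⁻¹ := by
      rw [gammaWord, hol_append W q (treeWord (boxVec L r) ++ seg κ L), disp_append, disp_treeWord, disp_seg,
        hol_revWord' W (x := q + (L : ℤ) • e κ) _ _ (by rw [disp_treeWord]; abel)]
    have h3 : hol W q (gammaWord L κ (boxVec L r)) = Wcx L W q κ (boxVec L r) * hol W q (seg κ L) := by
      rw [Wcx, inv_mul_cancel_right]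
    rw [← h1, ← mul_inv_eq_iff_eq_mul.mp (h2.symm.trans h3)]
  rw [hts, bavg]
  group

/-- Jensen on one block: `(Σ_r L^{−d}·‖ζ(w+r)‖)² ≤ L^{−d}·Σ_r ‖ζ(w+r)‖²`. [folklore] -/
theorem blockMean_norm_sq_le {L : ℕ} (hL : 1 ≤ L) (ζ : Site d → Matrix n n ℂ) (w : Site d) :
    (∑ r : Fin d → Fin L, (((L : ℝ) ^ d)⁻¹) * ‖ζ (w + boxVec L r)‖) ^ 2
      ≤ (((L : ℝ) ^ d)⁻¹) * ∑ r : Fin d → Fin L, ‖ζ (w + boxVec L r)‖ ^ 2 := by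
  have hL0 : (0 : ℝ) < (L : ℝ) ^ d := by positivity
  have hcard : ((Finset.univ : Finset (Fin d → Fin L)).card : ℝ) = (L : ℝ) ^ d := by
    rw [Finset.card_univ, Fintype.card_fun, Fintype.card_fin, Fintype.card_fin]; push_cast; ring
  have hcs := sq_sum_le_card_mul_sum_sq (s := (Finset.univ : Finset (Fin d → Fin L))) (f := fun r => ‖ζ (w + boxVec L r)‖)
  rw [hcard] at hcs
  rw [← Finset.mul_sum, mul_pow]
  calc (((L : ℝ) ^ d)⁻¹) ^ 2 * (∑ r : Fin d → Fin L, ‖ζ (w + boxVec L r)‖) ^ 2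
      ≤ (((L : ℝ) ^ d)⁻¹) ^ 2 * ((L : ℝ) ^ d * ∑ r : Fin d → Fin L, ‖ζ (w + boxVec L r)‖ ^ 2) :=
        mul_le_mul_of_nonneg_left hcs (by positivity)
    _ = (((L : ℝ) ^ d)⁻¹) * ∑ r : Fin d → Fin L, ‖ζ (w + boxVec L r)‖ ^ 2 := by
        field_simp


section Small

variable [Nonempty n] {L : ℕ} (hL : 1 ≤ L) {W : Site d → Fin d → (Matrix n n ℂ)ˣ} (hWu : IsUnitaryCfg W) {a : ℝ} (ha : 0 ≤ a)
  (h512 : 512 * (d + 1) * (d + 4) * (L : ℝ) ^ 2 * a ≤ 1) (hWa : SmallField W a)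

include hL hWu ha h512 hWa

/-- In the small-field class the mismatch unit is within `5·loopRad` of `1`:
`‖(V̄⁻¹T_rS_r)⁻¹T′_r − 1‖ = ‖W_{c,r}⁻¹e^{X_c} − 1‖ ≤ ‖e^{X_c} − 1‖ + ‖W_{c,r} − 1‖ ≤ 4·loopRad + loopRad`. [folklore] -/
theorem norm_mismatch_sub_one_le (z : Site d) (κ : Fin d) (r : Fin d → Fin L) :
    ‖((((bavg L W ((L : ℤ) • z) κ)⁻¹ * (hol W ((L : ℤ) • z) (treeWord (boxVec L r))
          * hol W ((L : ℤ) • z + boxVec L r) (seg κ L)))⁻¹ * hol W ((L : ℤ) • z + (L : ℤ) • e κ) (treeWord (boxVec L r))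
          : (Matrix n n ℂ)ˣ) : Matrix n n ℂ) - 1‖ ≤ 5 * loopRad d L a := by
  set q : Site d := (L : ℤ) • z with hq
  have hWu' : ∀ (x : Site d) (μ : Fin d), W x μ ∈ unitaryUnits (Matrix n n ℂ) := fun x μ => hWu x μ
  have hWc : Wcx L W q κ (boxVec L r) ∈ unitaryUnits (Matrix n n ℂ) :=
    (unitaryUnits _).mul_mem (hol_mem_of hWu' _ _) ((unitaryUnits _).inv_mem (hol_mem_of hWu' _ _))
  have hu : (hol W (q + (L : ℤ) • e κ) (treeWord (boxVec L r)))⁻¹ * (hol W q (seg κ L))⁻¹ ∈ unitaryUnits (Matrix n n ℂ) :=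
    (unitaryUnits _).mul_mem ((unitaryUnits _).inv_mem (hol_mem_of hWu' _ _)) ((unitaryUnits _).inv_mem (hol_mem_of hWu' _ _))
  rw [mismatch_unit_eq, norm_conj_sub_one_eq hu]
  -- `‖W⁻¹E − 1‖ = ‖W⁻¹(E − W)‖ ≤ ‖E − W‖ ≤ ‖E − 1‖ + ‖W − 1‖`
  have hWn : ‖(((Wcx L W q κ (boxVec L r))⁻¹ : (Matrix n n ℂ)ˣ) : Matrix n n ℂ)‖ ≤ 1 := (mem_U1_of_unitary hWc).2
  have hE : ‖((expUnit (Xavg L W q κ) : (Matrix n n ℂ)ˣ) : Matrix n n ℂ) - 1‖ ≤ 4 * loopRad d L a :=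
    norm_expUnit_Xavg_sub_one_le hL hWu ha h512 hWa z κ
  have hWx : ‖((Wcx L W q κ (boxVec L r) : (Matrix n n ℂ)ˣ) : Matrix n n ℂ) - 1‖ ≤ loopRad d L a :=
    loopBound_of_smallField hL hWu ha h512 hWa z κ r
  have hfac : ((((Wcx L W q κ (boxVec L r))⁻¹ * expUnit (Xavg L W q κ) : (Matrix n n ℂ)ˣ)) : Matrix n n ℂ) - 1
      = (((Wcx L W q κ (boxVec L r))⁻¹ : (Matrix n n ℂ)ˣ) : Matrix n n ℂ)
        * (((expUnit (Xavg L W q κ) : (Matrix n n ℂ)ˣ) : Matrix n n ℂ) - ((Wcx L W q κ (boxVec L r) : (Matrix n n ℂ)ˣ) : Matrix n n ℂ)) := by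
    rw [Units.val_mul, Matrix.mul_sub, Units.inv_mul]
  rw [hfac]
  calc ‖(((Wcx L W q κ (boxVec L r))⁻¹ : (Matrix n n ℂ)ˣ) : Matrix n n ℂ)
        * (((expUnit (Xavg L W q κ) : (Matrix n n ℂ)ˣ) : Matrix n n ℂ) - ((Wcx L W q κ (boxVec L r) : (Matrix n n ℂ)ˣ) : Matrix n n ℂ))‖
      ≤ ‖(((Wcx L W q κ (boxVec L r))⁻¹ : (Matrix n n ℂ)ˣ) : Matrix n n ℂ)‖
        * ‖((expUnit (Xavg L W q κ) : (Matrix n n ℂ)ˣ) : Matrix n n ℂ) - ((Wcx L W q κ (boxVec L r) : (Matrix n n ℂ)ˣ) : Matrix n n ℂ)‖ :=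
        norm_mul_le _ _
    _ ≤ 1 * (4 * loopRad d L a + loopRad d L a) := by
        refine mul_le_mul hWn ?_ (norm_nonneg _) zero_le_one
        have hsplit : ((expUnit (Xavg L W q κ) : (Matrix n n ℂ)ˣ) : Matrix n n ℂ) - ((Wcx L W q κ (boxVec L r) : (Matrix n n ℂ)ˣ) : Matrix n n ℂ)
            = (((expUnit (Xavg L W q κ) : (Matrix n n ℂ)ˣ) : Matrix n n ℂ) - 1)
              - (((Wcx L W q κ (boxVec L r) : (Matrix n n ℂ)ˣ) : Matrix n n ℂ) - 1) := by abel
        rw [hsplit]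
        exact (norm_sub_le _ _).trans (add_le_add hE hWx)
    _ = 5 * loopRad d L a := by ring

/-! ## §4 The defect bound -/

/-- **THE DEFECT OF THE STRAIGHT COVARIANT BLOCK-LINE AVERAGE ON AN EXACT FIELD** (one level, small-field class):
`‖Qstr L W (gaugeDir W ζ) z κ − gaugeDir (cavg L W) (bmean) z κ‖ ≤ 10·loopRad d L a·Σ_r L^{−d}‖ζ(L•z + L•e_κ + r)‖` — the comb-vs-`bseg`
transport mismatch costs `O(L²a)` times the block mean of `‖ζ‖` over `B(c₊)`; k-free. [folklore] -/
theorem norm_Qstr_gaugeDir_sub_le (ζ : Site d → Matrix n n ℂ) (z : Site d) (κ : Fin d) :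
    ‖Qstr L W (gaugeDir W ζ) z κ
        - gaugeDir (cavg L W) (fun w => ∑ r : Fin d → Fin L, (((L : ℝ) ^ d)⁻¹) •
            Ad (hol W ((L : ℤ) • w) (treeWord (boxVec L r))) (ζ ((L : ℤ) • w + boxVec L r))) z κ‖
      ≤ 10 * loopRad d L a * ∑ r : Fin d → Fin L, (((L : ℝ) ^ d)⁻¹) * ‖ζ ((L : ℤ) • z + (L : ℤ) • e κ + boxVec L r)‖ := by
  rw [Qstr_gaugeDir_sub_eq]
  letI : CStarAlgebra (Matrix n n ℂ) := {}
  have hρ : 0 ≤ loopRad d L a := by unfold loopRad; positivity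
  have hWu' : ∀ (x : Site d) (μ : Fin d), W x μ ∈ unitaryUnits (Matrix n n ℂ) := fun x μ => hWu x μ
  refine (norm_sum_le _ _).trans ?_
  rw [Finset.mul_sum]
  refine Finset.sum_le_sum fun r _ => ?_
  rw [norm_smul, Real.norm_eq_abs, abs_of_nonneg (by positivity)]
  have ha' : hol W ((L : ℤ) • z + (L : ℤ) • e κ) (treeWord (boxVec L r)) ∈ unitaryUnits (Matrix n n ℂ) := hol_mem_of hWu' _ _
  have hloop : ∀ r' : Fin d → Fin L, ‖((Wcx L W ((L : ℤ) • z) κ (boxVec L r') : (Matrix n n ℂ)ˣ) : Matrix n n ℂ) - 1‖ ≤ 1 / 4 :=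
    fun r' => (loopBound_of_smallField hL hWu ha h512 hWa z κ r').trans ((loopRad_le h512).trans (by norm_num))
  have hb' : (bavg L W ((L : ℤ) • z) κ)⁻¹ * (hol W ((L : ℤ) • z) (treeWord (boxVec L r)) * hol W ((L : ℤ) • z + boxVec L r) (seg κ L))
      ∈ unitaryUnits (Matrix n n ℂ) :=
    (unitaryUnits _).mul_mem ((unitaryUnits _).inv_mem (bavg_mem_unitaryUnits (𝔸 := Matrix n n ℂ) hWu' L ((L : ℤ) • z) κ hloop))
      ((unitaryUnits _).mul_mem (hol_mem_of hWu' _ _) (hol_mem_of hWu' _ _))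
  have h1 := norm_Ad_sub_Ad_le ha' hb' (ζ ((L : ℤ) • z + (L : ℤ) • e κ + boxVec L r))
  have h2 := norm_mismatch_sub_one_le hL hWu ha h512 hWa z κ r
  have hX : 0 ≤ ‖ζ ((L : ℤ) • z + (L : ℤ) • e κ + boxVec L r)‖ := norm_nonneg _
  have h3 : ‖Ad (hol W ((L : ℤ) • z + (L : ℤ) • e κ) (treeWord (boxVec L r))) (ζ ((L : ℤ) • z + (L : ℤ) • e κ + boxVec L r))
          - Ad ((bavg L W ((L : ℤ) • z) κ)⁻¹ * (hol W ((L : ℤ) • z) (treeWord (boxVec L r))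
              * hol W ((L : ℤ) • z + boxVec L r) (seg κ L))) (ζ ((L : ℤ) • z + (L : ℤ) • e κ + boxVec L r))‖
      ≤ 2 * (5 * loopRad d L a) * ‖ζ ((L : ℤ) • z + (L : ℤ) • e κ + boxVec L r)‖ :=
    h1.trans (mul_le_mul_of_nonneg_right (mul_le_mul_of_nonneg_left h2 (by norm_num)) hX)
  calc (((L : ℝ) ^ d)⁻¹) * ‖Ad (hol W ((L : ℤ) • z + (L : ℤ) • e κ) (treeWord (boxVec L r))) (ζ ((L : ℤ) • z + (L : ℤ) • e κ + boxVec L r))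
          - Ad ((bavg L W ((L : ℤ) • z) κ)⁻¹ * (hol W ((L : ℤ) • z) (treeWord (boxVec L r))
              * hol W ((L : ℤ) • z + boxVec L r) (seg κ L))) (ζ ((L : ℤ) • z + (L : ℤ) • e κ + boxVec L r))‖
      ≤ (((L : ℝ) ^ d)⁻¹) * (2 * (5 * loopRad d L a) * ‖ζ ((L : ℤ) • z + (L : ℤ) • e κ + boxVec L r)‖) :=
        mul_le_mul_of_nonneg_left h3 (by positivity)
    _ = 10 * loopRad d L a * ((((L : ℝ) ^ d)⁻¹) * ‖ζ ((L : ℤ) • z + (L : ℤ) • e κ + boxVec L r)‖) := by ring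

/-! ## §5 The torus ℓ² form of the defect bound -/

/-- **THE DEFECT IN ℓ²(TORUS)** (one level, small-field class): for an `(L·N)`-periodic generator `ζ`,
`Σ_{z∈periodBox N} Σ_κ ‖def(ζ)(z,κ)‖² ≤ d·(10·loopRad d L a)²·(L^d)⁻¹·Σ_{x∈periodBox (L·N)} ‖ζ x‖²` — each coarse bond sees the block
mean over `B(c₊)`; Jensen, shift invariance, tiling. [folklore] -/
theorem sum_norm_Qstr_gaugeDir_sub_sq_le {N : ℕ} (hN : 1 ≤ N) (ζ : Site d → Matrix n n ℂ)
    (hζ : ∀ (x : Site d) (τ : Fin d), ζ (x + ((L * N : ℕ) : ℤ) • e τ) = ζ x) :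
    ∑ z ∈ periodBox (d := d) N, ∑ κ : Fin d, ‖Qstr L W (gaugeDir W ζ) z κ
        - gaugeDir (cavg L W) (fun w => ∑ r : Fin d → Fin L, (((L : ℝ) ^ d)⁻¹) •
            Ad (hol W ((L : ℤ) • w) (treeWord (boxVec L r))) (ζ ((L : ℤ) • w + boxVec L r))) z κ‖ ^ 2
      ≤ (d : ℝ) * (10 * loopRad d L a) ^ 2 * (((L : ℝ) ^ d)⁻¹)
          * ∑ x ∈ periodBox (d := d) (L * N), ‖ζ x‖ ^ 2 := by
  have hρ : 0 ≤ 10 * loopRad d L a := by unfold loopRad; positivity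
  -- the block functional `m z := Σ_r L^{−d}·‖ζ(L•z + r)‖` and its square bound `g z`
  set g : Site d → ℝ := fun w => (((L : ℝ) ^ d)⁻¹) * ∑ r : Fin d → Fin L, ‖ζ ((L : ℤ) • w + boxVec L r)‖ ^ 2 with hg
  have hg_per : ∀ (w : Site d) (τ : Fin d), g (w + (N : ℤ) • e τ) = g w := by
    intro w τ
    simp only [hg]
    congr 1
    refine Finset.sum_congr rfl fun r _ => ?_
    have e1 : (L : ℤ) • (w + (N : ℤ) • e τ) + boxVec L r = ((L : ℤ) • w + boxVec L r) + ((L * N : ℕ) : ℤ) • e τ := by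
      rw [smul_add, smul_smul]; push_cast; abel
    rw [e1, hζ]
  -- pointwise: `‖def(ζ)(z,κ)‖² ≤ C²·g (z + e κ)`
  have hpt : ∀ (z : Site d) (κ : Fin d), ‖Qstr L W (gaugeDir W ζ) z κ
        - gaugeDir (cavg L W) (fun w => ∑ r : Fin d → Fin L, (((L : ℝ) ^ d)⁻¹) •
            Ad (hol W ((L : ℤ) • w) (treeWord (boxVec L r))) (ζ ((L : ℤ) • w + boxVec L r))) z κ‖ ^ 2
      ≤ (10 * loopRad d L a) ^ 2 * g (z + e κ) := by
    intro z κ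
    have h1 := norm_Qstr_gaugeDir_sub_le hL hWu ha h512 hWa ζ z κ
    have hq : (L : ℤ) • z + (L : ℤ) • e κ = (L : ℤ) • (z + e κ) := (smul_add _ _ _).symm
    simp only [hq] at h1
    have h0 := norm_nonneg (Qstr L W (gaugeDir W ζ) z κ
        - gaugeDir (cavg L W) (fun w => ∑ r : Fin d → Fin L, (((L : ℝ) ^ d)⁻¹) •
            Ad (hol W ((L : ℤ) • w) (treeWord (boxVec L r))) (ζ ((L : ℤ) • w + boxVec L r))) z κ)
    have h2 := blockMean_norm_sq_le hL ζ ((L : ℤ) • (z + e κ))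
    calc ‖Qstr L W (gaugeDir W ζ) z κ
        - gaugeDir (cavg L W) (fun w => ∑ r : Fin d → Fin L, (((L : ℝ) ^ d)⁻¹) •
            Ad (hol W ((L : ℤ) • w) (treeWord (boxVec L r))) (ζ ((L : ℤ) • w + boxVec L r))) z κ‖ ^ 2
        ≤ (10 * loopRad d L a * ∑ r : Fin d → Fin L, (((L : ℝ) ^ d)⁻¹) * ‖ζ ((L : ℤ) • (z + e κ) + boxVec L r)‖) ^ 2 :=
          pow_le_pow_left₀ h0 h1 2
      _ = (10 * loopRad d L a) ^ 2 * (∑ r : Fin d → Fin L, (((L : ℝ) ^ d)⁻¹) * ‖ζ ((L : ℤ) • (z + e κ) + boxVec L r)‖) ^ 2 := by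
          ring
      _ ≤ (10 * loopRad d L a) ^ 2 * g (z + e κ) := mul_le_mul_of_nonneg_left h2 (by positivity)
  -- sum: shift invariance in `z`, then the blocks tile the torus
  have hshift : ∀ κ : Fin d, ∑ z ∈ periodBox (d := d) N, g (z + e κ) = ∑ z ∈ periodBox (d := d) N, g z :=
    fun κ => sum_periodBox_shift N hN hg_per (e κ)
  have htile : ∑ z ∈ periodBox (d := d) N, g z = (((L : ℝ) ^ d)⁻¹) * ∑ x ∈ periodBox (d := d) (L * N), ‖ζ x‖ ^ 2 := by
    simp only [hg]
    rw [← Finset.mul_sum, ← sum_periodBox_blocks L N hL (fun x => ‖ζ x‖ ^ 2)]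
    congr 1
    exact Finset.sum_congr rfl fun w _ => sum_univ_boxVec L (fun v => ‖ζ ((L : ℤ) • w + v)‖ ^ 2)
  calc ∑ z ∈ periodBox (d := d) N, ∑ κ : Fin d, ‖Qstr L W (gaugeDir W ζ) z κ
        - gaugeDir (cavg L W) (fun w => ∑ r : Fin d → Fin L, (((L : ℝ) ^ d)⁻¹) •
            Ad (hol W ((L : ℤ) • w) (treeWord (boxVec L r))) (ζ ((L : ℤ) • w + boxVec L r))) z κ‖ ^ 2
      ≤ ∑ z ∈ periodBox (d := d) N, ∑ κ : Fin d, (10 * loopRad d L a) ^ 2 * g (z + e κ) :=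
        Finset.sum_le_sum fun z _ => Finset.sum_le_sum fun κ _ => hpt z κ
    _ = (10 * loopRad d L a) ^ 2 * ∑ κ : Fin d, ∑ z ∈ periodBox (d := d) N, g (z + e κ) := by
        rw [Finset.sum_comm, Finset.mul_sum]
        exact Finset.sum_congr rfl fun κ _ => by rw [Finset.mul_sum]
    _ = (10 * loopRad d L a) ^ 2 * ((d : ℝ) * ((((L : ℝ) ^ d)⁻¹) * ∑ x ∈ periodBox (d := d) (L * N), ‖ζ x‖ ^ 2)) := by
        simp only [hshift, htile, Finset.sum_const, Finset.card_univ, Fintype.card_fin, nsmul_eq_mul]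
    _ = (d : ℝ) * (10 * loopRad d L a) ^ 2 * (((L : ℝ) ^ d)⁻¹) * ∑ x ∈ periodBox (d := d) (L * N), ‖ζ x‖ ^ 2 := by ring

end Small

end

end Summit.QuantumFields.BalabanUV.T4Continuum.NE3ExactLineSums
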